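import Summits.BirchSwinnertonDyer.BirchSwinnertonDyer.Theorems.PrintCf2SplitBadTwoFirstLayerInertAtSeven
import HarnessLib

/-!
# Crux `PrintCf2.SplitBadTwoRankOneOfFacts` (stmt-BirchSwinnertonDyer-20368), road α v10.3 — brick B15 §2, file 5:
# `v̄` RAMIFIES ALREADY IN THE FIRST LAYER, so NEITHER `v̄` NOR `w₇` SPLITS COMPLETELY in any `ℤ₂`-line of the frame field unramified outside `v̄`

Cell `bsd-print-cf2`, width seat `bsd-line-cf2-p1-w6` g2 (prover-bsd-line-cf2-p1-w6-g2-0); `--supports stmt-BirchSwinnertonDyer-20368`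
(helper, Theses-free). HONEST FRAMING: nothing here closes the crux or a registered stub; BSD is not proved by any of this; no summit
statement is proved by this seat. No definition, no named fact, no `sorry`.

WHAT. Two more CLASS-FIELD-THEORY-SHAPED hypotheses of the S3c₂ assembly are theorems of the first-layer identification
`κ⁻¹(2ℤ₂) = Stab(√−β)` (file 3b, `layerSubgroup_one_eq_stabilizer_geomSqrt_neg`):
* `not_inertia_vbar_le_layerSubgroup_one_of_frame` — `I_{v̄} ⊄ κ⁻¹(2ℤ₂)`: `ord_{v̄}(−β) = 1` is odd, so `I_{v̄}` moves `√−β` (file 2's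
  Kummer parity at EVERY place, `two_dvd_log_valuation_of_inertia_le_stabilizer`): the line is RAMIFIED at `v̄` already in `K₁` (no
  everywhere-unramified quadratic extension of `ℚ(√−7)` survives: `h_K = 1` replaced by Kummer + units);
* **`not_decomp_vbar_le_kerSubgroup_of_frame`** — `v̄` does not split completely in `K*_∞` (`D_{v̄} ⊇ I_{v̄}`, `ker κ ≤ κ⁻¹(2ℤ₂)`): the
  displayed hypothesis «`¬ decomp v̄ ≤ κ'.kerSubgroup`» of -w2 g9's `natCard_localKer_vbar_eq_two_of_frame` (p664385, (R-DYADIC)) HOLDS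
  on every frame; also `not_isUnramifiedOutside_v_of_frame` (the `v̄`-line is not the `v`-line);
* **`not_decomp_seven_le_kerSubgroup_of_frame`** — `w₇` does not split completely in `K*_∞` ((R-CFT / C1) of LEAD g12's
  `restrictedControl_two_of_residuals` AT THE PLACE ABOVE `7`, from (H7), file 4); the generic door `not_decomp_le_kerSubgroup_of_exists_smul_ne`
  (any `w` with one `δ ∈ D_w` moving `√−β`, e.g. an odd `w ∣ d` at which `−β` is a non-residue).
What stays CFT: (C1) at the odd places `w ∣ d` where `−β` IS a residue (there `w` splits in `K₁` and the question moves to higher layers),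
and (C3) (the kernel of `κ` at `v̄`). presearch: Washington Prop. 13.2/§13.1, Neukirch VI (6.6) (conductor–discriminant), memo
`B15-DYADIC-EXACT-w2g9.md` §1 — held; no new Literature fact. beyond-print theorem: no.

References: [Washington1997] §13.1 and Prop. 13.2; [NeukirchANT1999] Ch. II §9 (9.6), Ch. VI (6.6); [Lang1983] Ch. 6 Prop. 1.3;
[Agboola2007] §3 Prop. 3.2.
-/

noncomputable section

open scoped Classical NumberField

set_option linter.dupNamespace false
set_option autoImplicit false

open NumberField IsDedekindDomain Field WeierstrassCurve
open Literature.NumberTheory Literature.NumberTheory.EllipticCurves Literature.NumberTheory.GaloisRepresentations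

namespace Summit.BirchSwinnertonDyer.BirchSwinnertonDyer.Theorems.PrintCf2.FirstLayer

variable {K : Type} [Field K] [NumberField K]

/-- **Generic door: a place with one decomposition element moving `√−β` does not split completely in the line** (`ker κ ≤ κ⁻¹(2ℤ₂)`,
file 3b's `not_decomp_le_layerSubgroup_one_of_exists_smul_ne`). [cite: NeukirchANT1999, Ch. I §8 Prop. (8.3)] -/
theorem not_decomp_le_kerSubgroup_of_exists_smul_ne (hK : IsImaginaryQuadratic K) {θ : K} (hθ : θ ^ 2 = -7) {d : ℤ}
    (hd0 : d ≠ 0) (W : WeierstrassCurve ℚ) [W.IsElliptic] {C : VariableChange ℚ} (hC : C • W = cm7.quadraticTwist (d : ℚ))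
    {v vbar : HeightOneSpectrum (𝓞 K)} (hv : ((2 : ℕ) : 𝓞 K) ∈ v.asIdeal) (hvbar : ((2 : ℕ) : 𝓞 K) ∈ vbar.asIdeal)
    (hne : vbar ≠ v) {β : 𝓞 K} (hβ : β * (1 - β) = 2) (hβvbar : β ∈ vbar.asIdeal)
    (κ : ZpExtension K 2) (hκ : κ.IsUnramifiedOutside vbar) {w : HeightOneSpectrum (𝓞 K)}
    (hw : ∃ δ ∈ GreenbergSelmer.decomp w, δ • geomSqrt (-(β : K)) ≠ geomSqrt (-(β : K))) :
    ¬ GreenbergSelmer.decomp w ≤ κ.kerSubgroup := fun hle ↦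
  not_decomp_le_layerSubgroup_one_of_exists_smul_ne hK hθ hd0 W hC hv hvbar hne hβ hβvbar κ hκ hw
    (hle.trans (κ.kerSubgroup_le_layerSubgroup 1))

/-- **`v̄` RAMIFIES IN THE FIRST LAYER: `I_{v̄} ⊄ κ⁻¹(2ℤ₂)`** on every frame, for every `ℤ₂`-line `κ` unramified outside `v̄`: the first
layer is `K(√−β)` (file 3b) and `ord_{v̄}(−β) = 1` is odd, so the inertia group at `v̄` cannot fix `√−β` (Kummer parity, every place).
[cite: Lang1983, Ch. 6 Prop. 1.3] [cite: Washington1997, Prop. 13.2 and §13.1] -/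
theorem not_inertia_vbar_le_layerSubgroup_one_of_frame (hK : IsImaginaryQuadratic K) {θ : K} (hθ : θ ^ 2 = -7) {d : ℤ}
    (hd0 : d ≠ 0) (W : WeierstrassCurve ℚ) [W.IsElliptic] {C : VariableChange ℚ} (hC : C • W = cm7.quadraticTwist (d : ℚ))
    {v vbar : HeightOneSpectrum (𝓞 K)} (hv : ((2 : ℕ) : 𝓞 K) ∈ v.asIdeal) (hvbar : ((2 : ℕ) : 𝓞 K) ∈ vbar.asIdeal)
    (hne : vbar ≠ v) (κ : ZpExtension K 2) (hκ : κ.IsUnramifiedOutside vbar) :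
    ¬ GreenbergSelmer.inertia vbar ≤ κ.layerSubgroup 1 := by
  obtain ⟨β, hβ, hβvbar⟩ := exists_mul_one_sub_eq_two_mem hθ hvbar
  rw [layerSubgroup_one_eq_stabilizer_geomSqrt_neg hK hθ hd0 W hC hv hvbar hne hβ hβvbar κ hκ]
  intro hle
  have h2vbar := intValuation_two_of_frame hK hθ hd0 W hC hvbar
  obtain ⟨hβ1, -⟩ := intValuation_vbar h2vbar hβ hβvbar
  have hβ0 : (-(β : K)) ≠ 0 := by
    rw [neg_ne_zero]
    intro h
    have hb : β = 0 := by exact_mod_cast h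
    rw [hb, zero_mul] at hβ
    exact two_ne_zero hβ.symm
  have hdvd := two_dvd_log_valuation_of_inertia_le_stabilizer vbar hβ0 hle
  have hval : vbar.valuation K (-(β : K)) = WithZero.exp (-1 : ℤ) := by
    rw [Valuation.map_neg, show (β : K) = algebraMap (𝓞 K) K β from rfl, HeightOneSpectrum.valuation_of_algebraMap, hβ1]
  rw [hval, WithZero.log_exp] at hdvd
  omega

/-- **`v̄` DOES NOT SPLIT COMPLETELY IN THE LINE: `¬ D_{v̄} ≤ ker κ`** on every frame, every `κ` unramified outside `v̄` (`I_{v̄} ≤ D_{v̄}`,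
`ker κ ≤ κ⁻¹(2ℤ₂)`). This is the displayed hypothesis «`¬ decomp v̄ ≤ κ'.kerSubgroup`» of -w2 g9's `natCard_localKer_vbar_eq_two_of_frame`
(B15 (R-DYADIC), p664385) — now a theorem, no class field theory. [cite: Washington1997, §13.1] [cite: NeukirchANT1999, Ch. II §9 (9.6)] -/
theorem not_decomp_vbar_le_kerSubgroup_of_frame (hK : IsImaginaryQuadratic K) {θ : K} (hθ : θ ^ 2 = -7) {d : ℤ}
    (hd0 : d ≠ 0) (W : WeierstrassCurve ℚ) [W.IsElliptic] {C : VariableChange ℚ} (hC : C • W = cm7.quadraticTwist (d : ℚ))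
    {v vbar : HeightOneSpectrum (𝓞 K)} (hv : ((2 : ℕ) : 𝓞 K) ∈ v.asIdeal) (hvbar : ((2 : ℕ) : 𝓞 K) ∈ vbar.asIdeal)
    (hne : vbar ≠ v) (κ : ZpExtension K 2) (hκ : κ.IsUnramifiedOutside vbar) :
    ¬ GreenbergSelmer.decomp vbar ≤ κ.kerSubgroup := fun hle ↦
  not_inertia_vbar_le_layerSubgroup_one_of_frame hK hθ hd0 W hC hv hvbar hne κ hκ
    (((GreenbergSelmer.inertia_le_decomp vbar).trans hle).trans (κ.kerSubgroup_le_layerSubgroup 1))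

/-- **The `v̄`-line is ramified at `v̄`: `¬ I_{v̄} ≤ ker κ`** — in particular a `ℤ₂`-line of the frame field unramified outside `v̄` is NOT
unramified outside `v` as well (no everywhere-unramified `ℤ₂`-line; the `v`-line and the `v̄`-line differ). [cite: Washington1997, Prop. 13.2] -/
theorem not_inertia_vbar_le_kerSubgroup_of_frame (hK : IsImaginaryQuadratic K) {θ : K} (hθ : θ ^ 2 = -7) {d : ℤ}
    (hd0 : d ≠ 0) (W : WeierstrassCurve ℚ) [W.IsElliptic] {C : VariableChange ℚ} (hC : C • W = cm7.quadraticTwist (d : ℚ))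
    {v vbar : HeightOneSpectrum (𝓞 K)} (hv : ((2 : ℕ) : 𝓞 K) ∈ v.asIdeal) (hvbar : ((2 : ℕ) : 𝓞 K) ∈ vbar.asIdeal)
    (hne : vbar ≠ v) (κ : ZpExtension K 2) (hκ : κ.IsUnramifiedOutside vbar) :
    ¬ GreenbergSelmer.inertia vbar ≤ κ.kerSubgroup := fun hle ↦
  not_inertia_vbar_le_layerSubgroup_one_of_frame hK hθ hd0 W hC hv hvbar hne κ hκ (hle.trans (κ.kerSubgroup_le_layerSubgroup 1))

/-- **No `ℤ₂`-line of the frame field is unramified outside BOTH places above `2`**: a line unramified outside `v̄` is not unramified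
outside `v` (it ramifies at `v̄`). [cite: Washington1997, Prop. 13.2 and §13.1] -/
theorem not_isUnramifiedOutside_v_of_frame (hK : IsImaginaryQuadratic K) {θ : K} (hθ : θ ^ 2 = -7) {d : ℤ}
    (hd0 : d ≠ 0) (W : WeierstrassCurve ℚ) [W.IsElliptic] {C : VariableChange ℚ} (hC : C • W = cm7.quadraticTwist (d : ℚ))
    {v vbar : HeightOneSpectrum (𝓞 K)} (hv : ((2 : ℕ) : 𝓞 K) ∈ v.asIdeal) (hvbar : ((2 : ℕ) : 𝓞 K) ∈ vbar.asIdeal)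
    (hne : vbar ≠ v) (κ : ZpExtension K 2) (hκ : κ.IsUnramifiedOutside vbar) : ¬ κ.IsUnramifiedOutside v := fun hκv ↦
  not_inertia_vbar_le_kerSubgroup_of_frame hK hθ hd0 W hC hv hvbar hne κ hκ (hκv vbar hne)

/-- **`w₇` DOES NOT SPLIT COMPLETELY IN THE LINE: `¬ D_{w₇} ≤ ker κ`** — (R-CFT / C1) of the S3c₂ assembly AT THE PLACE ABOVE `7`, on every
frame, from (H7) (file 4) and `ker κ ≤ κ⁻¹(2ℤ₂)`. [cite: NeukirchANT1999, Ch. I §8 Prop. (8.3)] [cite: Agboola2007, §3 Prop. 3.2] -/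
theorem not_decomp_seven_le_kerSubgroup_of_frame (hK : IsImaginaryQuadratic K) {θ : K} (hθ : θ ^ 2 = -7) {d : ℤ}
    (hd0 : d ≠ 0) (W : WeierstrassCurve ℚ) [W.IsElliptic] {C : VariableChange ℚ} (hC : C • W = cm7.quadraticTwist (d : ℚ))
    {v vbar : HeightOneSpectrum (𝓞 K)} (hv : ((2 : ℕ) : 𝓞 K) ∈ v.asIdeal) (hvbar : ((2 : ℕ) : 𝓞 K) ∈ vbar.asIdeal)
    (hne : vbar ≠ v) (κ : ZpExtension K 2) (hκ : κ.IsUnramifiedOutside vbar) {w : HeightOneSpectrum (𝓞 K)}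
    (h7 : ((7 : ℕ) : 𝓞 K) ∈ w.asIdeal) : ¬ GreenbergSelmer.decomp w ≤ κ.kerSubgroup := fun hle ↦
  not_decomp_seven_le_layerSubgroup_one_of_frame hK hθ hd0 W hC hv hvbar hne κ hκ h7 (hle.trans (κ.kerSubgroup_le_layerSubgroup 1))

/-- **The same three non-splitting facts with `√−7 ∈ K` read off a `K`-rational CM endomorphism** (`π ∈ End_K(E_K)`, `π² = π − 2`, as in the
S3c₂ frame; -w3 g7 `exists_sq_eq_neg_seven_of_cmEndo_mem_endRing`) and the place above `7` supplied (`exists_heightOneSpectrum_natCast_mem`):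
`¬ D_{v̄} ≤ ker κ′` and, at some `w₇ ∋ 7`, `¬ D_{w₇} ≤ ker κ′` and `¬ D_{w₇} ≤ κ′⁻¹(2ℤ₂)`. [cite: Agboola2007, §3 Prop. 3.2] -/
theorem not_decomp_le_kerSubgroup_of_cmEndo_frame {d : ℤ} (hd0 : d ≠ 0) (W : WeierstrassCurve ℚ) [W.IsElliptic]
    (C : VariableChange ℚ) (hC : C • W = cm7.quadraticTwist (d : ℚ)) (hK : IsImaginaryQuadratic K)
    (v vbar : HeightOneSpectrum (𝓞 K)) (hv : ((2 : ℕ) : 𝓞 K) ∈ v.asIdeal) (hvbar : ((2 : ℕ) : 𝓞 K) ∈ vbar.asIdeal) (hne : vbar ≠ v)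
    (π : (W.baseChange K).endRing) (hrel : (π : AddMonoid.End (W.baseChange K).geomPoints) * π = π - 2)
    (κ' : ZpExtension K 2) (hκ' : κ'.IsUnramifiedOutside vbar) :
    ¬ GreenbergSelmer.decomp vbar ≤ κ'.kerSubgroup ∧
      ∃ w₇ : HeightOneSpectrum (𝓞 K), ((7 : ℕ) : 𝓞 K) ∈ w₇.asIdeal ∧
        ¬ GreenbergSelmer.decomp w₇ ≤ κ'.kerSubgroup ∧ ¬ GreenbergSelmer.decomp w₇ ≤ κ'.layerSubgroup 1 := by
  have hj : W.j = -3375 := AdditiveAtSeven.j_eq_of_smul_eq_cm7Twist hd0 W C hC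
  obtain ⟨θ, hθ⟩ := RestrictedSelmerPair.exists_sq_eq_neg_seven_of_cmEndo_mem_endRing W K hj π hrel
  obtain ⟨w, h7⟩ := AdditiveAtSeven.exists_heightOneSpectrum_natCast_mem (K := K) (q := 7) (by norm_num)
  exact ⟨not_decomp_vbar_le_kerSubgroup_of_frame hK hθ hd0 W hC hv hvbar hne κ' hκ', w, h7,
    not_decomp_seven_le_kerSubgroup_of_frame hK hθ hd0 W hC hv hvbar hne κ' hκ' h7,
    not_decomp_seven_le_layerSubgroup_one_of_frame hK hθ hd0 W hC hv hvbar hne κ' hκ' h7⟩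

end Summit.BirchSwinnertonDyer.BirchSwinnertonDyer.Theorems.PrintCf2.FirstLayer

end
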